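import Summits.ResolutionOfSingularities.ResolutionOfSingularities.Theorems.FrobeniusClosingSteerHeartDivergent
import HarnessLib

/-!
# Crux `Steer` (stmt-ResolutionOfSingularities-16345), line `switching_dichotomy`: the (α) heart is DENSE —
# no toroidal log-exit + divergent exceptional values ⇒ `t` is a limit of members of the point sequence

OURS (campaign `res-hironaka`, rung L ★L-G4, slot W4.1; seat `res-L0-w41-strat-1` g5, crux-strategist alongside the
holder `res-L0-w41-lead-1`; Theses-free helper `--supports stmt-ResolutionOfSingularities-16345`).

**`dense_of_forall_not_toroidal`.** Let `A₀ ⊆ O` be regular at the centre of the zero-dimensional valuation ring `O`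
(perfect ground field `k` of characteristic `p`), `t ^ p ∈ A₀` with `t ∉ Frac A₀`, and let `R` be the point sequence
of `A₀` along `O`. Assume (i) NO member `R N` is toroidally log-final for any `t₂ ∉ Frac A₀` (the E2 clause of the
skeleton's `¬ LogExitAt (R N) p A₀ t`, unfolded: `t₂ ^ p` is never an rsop-monomial with an exponent prime to `p` times
a unit) and (ii) the exceptional values DIVERGE (`∀ c ≠ 0, ∃ n, ∏_{i<n} v (x i) < v c` for exceptional parameters
`x i` of the members — the divergence binder of the heart `EternalCyclesSSM`, or E-8 `divergent_of_core_not_isTorsorRun`).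
Then for every `w ≠ 0` some member `R M` contains `g` with `v (t - g) < v w`: the torsor of `t` is DENSE, i.e. `t`
lies in the completion of `Frac A₀` — the «finite distance» half of the D1 cut of the heart is EMPTY.

Mechanism (a LAZY FRAMED RUN, no strong switching / rank one / archimedean step needed): by induction on `M` keep
`(t - g) ^ p = P · r` with `P` an rsop-monomial times a unit of `R M`, `r ∈ 𝔪_{R M} ∖ 0`, `v P ≤ ∏_{i<M} v (x i)`.
Step `M → M + 1`: complete the frame to a regular system of parameters, let `x'` be its member of maximal value
(an exceptional parameter, `𝔪_{R M} ⊆ x' · R (M+1)`), transport the frame by `stub_rsopMonomialStep`; then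
`P · x'` is a monomial of the new frame and `r / x' ∈ R (M + 1)`. If `r / x'` is a non-unit, keep `g`. If it is a
unit `W`, hypothesis (i) for `t₂ := t - g ∉ Frac A₀` forces every exponent to be divisible by `p`, so
`(t - g) ^ p = μ ^ p · W` with `μ ∈ R (M + 1)`; the residue field being perfect, `W = c ^ p + u″` with `c` a unit and
`u″ ∈ 𝔪`, and `g⁺ := g + μ c` gives `(t - g⁺) ^ p = μ ^ p · u″`, `u″ ≠ 0` as `t ∉ Frac A₀`. Values multiply by
`v x' = v (x M)` at every step, so `v ((t - g_M) ^ p) ≤ ∏_{i<M} v (x i) → 0` by (ii).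

Consequence for the skeleton of record (r28/r30, stub `stub_eternalCyclesSSM`): `EternalCyclesSSM` follows from the
same statement with the extra binder `(∀ w : K, w ≠ 0 → ∃ M g, g ∈ R M ∧ O.valuation (t - g) < O.valuation w)`
(«S3ᴹ∞»); the heart is the INFINITE-DISTANCE / dense case only.

Sources: W. Heinzer, B. Olberding, M. Toeniskoetter, *Asymptotic properties of infinite directed unions of local
quadratic transforms*, J. Algebra 479 (2017), Prop. 6.2 (exceptional values along point sequences);
F. J. Herrera Govantes, M. A. Olalla Acosta, M. Spivakovsky, B. Teissier, *Extending a valuation centred in a local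
domain to the formal completion*, Proc. LMS 105 (2012) = arXiv:1007.4658, §2 (implicit ideals: the limit of the `g_M`
lives in the completion); V. Cossart, O. Piltant, J. Algebra 529 (2019), §2 (`p`-th power cleaning).
-/

-- `Summit.<S>.<S>.…` duplicates the summit name by design (single-problem summit).
set_option linter.dupNamespace false

open IsLocalRing
open Literature.AlgebraicGeometry.Resolution

namespace Summit.ResolutionOfSingularities.ResolutionOfSingularities.Theorems.SwitchingDichotomy

namespace EventualMonomial

variable {k K : Type} [Field k] [Field K] [Algebra k K]

/-! ## Frame transport along one quadratic transform, exporting the exceptional parameter -/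

/-- **Framed step.** Along a quadratic transform `R → R₁` of local rings dominated by `O`, a part `z` of a regular
system of parameters of `R` is transported to a part `z₁` of a regular system of parameters of `R₁` in which every
`z j` AND an exceptional parameter `x'` of the step (`x' ∈ 𝔪_R` non-zero of maximal value, with `𝔪_R ⊆ x' · R₁`) are
monomials times units. (Complete `z` to a regular system of parameters, take its member of maximal value, apply
`stub_rsopMonomialStep` to the full system.) [cite: HeinzerEtAl2015, Lemma 2.7] [folklore] -/
theorem exists_frame_step (O : ValuationSubring K) (R R₁ : Subring K) [IsLocalRing R] [IsLocalRing R₁]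
    (hdom : SubringDominates R O.toSubring) (hdom₁ : SubringDominates R₁ O.toSubring)
    (h : IsQuadraticTransformAlong O R R₁) {s : ℕ} (z : Fin s → R) (hz : IsRsopPart z) :
    ∃ x : K, x ∈ R ∧ x ≠ 0 ∧ O.valuation x < 1 ∧
      (∀ y ∈ R, O.valuation y < 1 → O.valuation y ≤ O.valuation x) ∧
      (∀ y ∈ R, O.valuation y < 1 → y / x ∈ R₁) ∧
      ∃ (s₁ : ℕ) (z₁ : Fin s₁ → R₁), IsRsopPart z₁ ∧
        (∀ j : Fin s, ∃ (e : Fin s₁ → ℕ) (u : R₁), IsUnit u ∧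
          ((z j : R) : K) = (∏ l, ((z₁ l : R₁) : K) ^ e l) * (u : K)) ∧
        ∃ (e : Fin s₁ → ℕ) (u : R₁), IsUnit u ∧ x = (∏ l, ((z₁ l : R₁) : K) ^ e l) * (u : K) := by
  classical
  haveI := hz.isRegularLocalRing
  have hRO : R ≤ O.toSubring := hdom.1
  have hR₁O : R₁ ≤ O.toSubring := hdom₁.1
  obtain ⟨e, x, hd, hx, hxz⟩ := hz.exists_rsop
  have hxpart : IsRsopPart x := isRsopPart_comp_of_rsop hd x hx id Function.injective_id
  obtain ⟨_, x₀, hx₀m, hx₀0, hx₀max, hR₁⟩ := h.exists_eq_locAtCentre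
  have hx₀0' : ((x₀ : R) : K) ≠ 0 := fun h0 => hx₀0 (Subtype.ext h0)
  -- some parameter is nonzero (as `𝔪_R ≠ 0`)
  have hne : ∃ j ∈ (Finset.univ : Finset (Fin (s + e))), ((x j : R) : K) ≠ 0 := by
    by_contra hcon
    have hall : ∀ j, x j = 0 := fun j => by
      by_contra hj
      exact hcon ⟨j, Finset.mem_univ j, fun h0 => hj (Subtype.ext h0)⟩
    have hbot : Ideal.span (Set.range x) = ⊥ := by
      rw [Ideal.span_eq_bot]
      rintro _ ⟨j, rfl⟩
      exact hall j
    rw [hx] at hbot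
    rw [hbot] at hx₀m
    exact hx₀0 ((Submodule.mem_bot _).mp hx₀m)
  obtain ⟨i, -, hi0, hmax⟩ := exists_max_valuation O Finset.univ (fun j => ((x j : R) : K)) hne
  have hxim : x i ∈ maximalIdeal R := hx ▸ Ideal.subset_span ⟨i, rfl⟩
  have hvxi : O.valuation ((x i : R) : K) < 1 :=
    ((subringDominates_valuationSubring_iff hRO).mp hdom (x i)).mp hxim
  -- `x i` has maximal value on the whole maximal ideal
  have hmaxm : ∀ y ∈ maximalIdeal R, O.valuation ((y : R) : K) ≤ O.valuation ((x i : R) : K) := by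
    intro y hy
    rw [← hx] at hy
    induction hy using Submodule.span_induction with
    | mem y hy =>
      obtain ⟨j, rfl⟩ := hy
      exact hmax j (Finset.mem_univ j)
    | zero => simp
    | add y y' _ _ hy hy' =>
      rw [Subring.coe_add]
      exact (Valuation.map_add _ _ _).trans (max_le hy hy')
    | smul a y _ hy =>
      rw [smul_eq_mul, Subring.coe_mul, map_mul]
      exact mul_le_of_le_one_of_le ((O.valuation_le_one_iff _).mpr (hRO a.2)) hy
  have hveq : O.valuation ((x i : R) : K) = O.valuation ((x₀ : R) : K) :=
    le_antisymm (hx₀max (x i) hxim) (hmaxm x₀ hx₀m)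
  -- `x i / x₀` is a unit of `R₁`
  have hqmem : ((x i : R) : K) / ((x₀ : R) : K) ∈ R₁ := by
    rw [hR₁]
    exact le_locAtCentre _ O (div_mem_blowupRing _ hxim)
  have hq1 : O.valuation (((x i : R) : K) / ((x₀ : R) : K)) = 1 := by
    rw [map_div₀, hveq, div_self ((map_ne_zero _).mpr hx₀0')]
  have hqinv : ((x₀ : R) : K) / ((x i : R) : K) ∈ R₁ := by
    rw [← inv_div]
    exact hdom₁.2 _ hqmem ((O.valuation_le_one_iff _).mp (by rw [map_inv₀, hq1, inv_one]))
  obtain ⟨s₁, z₁, hz₁, hmono⟩ := stub_rsopMonomialStep K O R R₁ hdom h (s + e) x hxpart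
  refine ⟨((x i : R) : K), (x i).2, hi0, hvxi, fun y hy hvy => ?_, fun y hy hvy => ?_, s₁, z₁, hz₁,
    fun j => ?_, hmono i⟩
  · exact hmaxm ⟨y, hy⟩ (((subringDominates_valuationSubring_iff hRO).mp hdom ⟨y, hy⟩).mpr hvy)
  · have hym : (⟨y, hy⟩ : R) ∈ maximalIdeal R :=
      ((subringDominates_valuationSubring_iff hRO).mp hdom ⟨y, hy⟩).mpr hvy
    have hy₀ : y / ((x₀ : R) : K) ∈ R₁ := by
      rw [hR₁]
      exact le_locAtCentre _ O (div_mem_blowupRing _ hym)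
    have hfac : y / ((x i : R) : K) = y / ((x₀ : R) : K) * (((x₀ : R) : K) / ((x i : R) : K)) := by
      rw [div_mul_div_comm, mul_comm ((x₀ : R) : K) ((x i : R) : K), mul_div_mul_right _ _ hx₀0']
    rw [hfac]
    exact Subring.mul_mem _ hy₀ hqinv
  · rw [← hxz j]
    exact hmono (Fin.castAdd e j)

/-! ## Monomial bookkeeping -/

/-- Transport of a monomial expression along a change of frame: if every `z j` is a `z₁`-monomial times a unit of
the larger ring `S₁ ⊇ S` then so is every `z`-monomial times a unit of `S`. [folklore] -/
theorem monomial_transport {S S₁ : Subring K} (hle : S ≤ S₁) {s s₁ : ℕ} {z : Fin s → S} {z₁ : Fin s₁ → S₁}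
    (H : ∀ j : Fin s, ∃ (e : Fin s₁ → ℕ) (u : S₁), IsUnit u ∧
      ((z j : S) : K) = (∏ l, ((z₁ l : S₁) : K) ^ e l) * (u : K))
    {b : K} (E : Fin s → ℕ) {u : S} (hu : IsUnit u) (hb : b = (∏ j, ((z j : S) : K) ^ E j) * (u : K)) :
    ∃ (e : Fin s₁ → ℕ) (u₁ : S₁), IsUnit u₁ ∧ b = (∏ l, ((z₁ l : S₁) : K) ^ e l) * (u₁ : K) := by
  classical
  choose e' u' hu' hzu' using H
  refine ⟨fun l => ∑ j, E j * e' j l, (∏ j, u' j ^ E j) * Subring.inclusion hle u,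
    (IsUnit.prod_univ_iff.mpr fun j => (hu' j).pow _).mul (hu.map _), ?_⟩
  rw [hb]
  simp only [hzu', mul_pow]
  rw [Finset.prod_mul_distrib, prod_prod_pow_pow, mul_assoc]
  push_cast
  simp only [Subring.coe_inclusion]

/-- The product of two monomials (times units) in the same frame is one. [folklore] -/
theorem monomial_mul {S : Subring K} {s : ℕ} (z : Fin s → S) {b c : K} {E F : Fin s → ℕ} {u w : S}
    (hb : b = (∏ l, ((z l : S) : K) ^ E l) * (u : K)) (hc : c = (∏ l, ((z l : S) : K) ^ F l) * (w : K)) :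
    b * c = (∏ l, ((z l : S) : K) ^ (E l + F l)) * ((u * w : S) : K) := by
  rw [hb, hc, Subring.coe_mul]
  simp only [pow_add, Finset.prod_mul_distrib]
  ring

/-! ## The theorem -/

/-- **The (α) heart is dense: no toroidal log-exit + divergent exceptional values ⇒ `t` is a limit of members.**
See the module docstring for the lazy framed run. Hypotheses `hzd` (= `ZeroDim`, perfect residue fields of members),
`htF` (`t ∉ Frac A₀`, e.g. from «`t ^ p` not a `p`-th power at the centre» by `SteeredRun.not_mem_closure_of_ne_pow`),
`hnl` (the E2 clause of `¬ LogExitAt (R N) p A₀ t` for every `N`), `hdiv` (the divergence binder of `EternalCyclesSSM`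
after `¬ HasProperCoarsening O`, `IsExcParam` unfolded). OURS. [cite: HeinzerOlberdingToeniskoetter2017, Prop. 6.2]
[cite: CossartPiltant2019, §2] [folklore] -/
theorem dense_of_forall_not_toroidal (p : ℕ) (hp : p.Prime) [CharP k p] [PerfectField k]
    (O : ValuationSubring K) (A₀ : Subalgebra k K) (h₀ : A₀.toSubring ≤ O.toSubring) (t : K)
    (htp : t ^ p ∈ A₀)
    (hreg : IsRegularLocalRing (Localization.AtPrime
      (Ideal.comap (Subring.inclusion h₀) (IsLocalRing.maximalIdeal O))))
    (hzd : ∀ x ∈ O, ∃ f : Polynomial k, f ≠ 0 ∧ Polynomial.aeval (R := k) x f ∈ O.nonunits)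
    (htF : ¬ ∃ y ∈ A₀, ∃ z ∈ A₀, z ≠ 0 ∧ t = y / z)
    (R : ℕ → Subring K) (hR0 : R 0 = locAtCentre A₀.toSubring O)
    (hstep : ∀ i, IsQuadraticTransformAlong O (R i) (R (i + 1)))
    (hnl : ∀ (N : ℕ) (_ : IsLocalRing (R N)) (t₂ : K), ¬ (∃ y ∈ A₀, ∃ z ∈ A₀, z ≠ 0 ∧ t₂ = y / z) →
      ¬ ∃ (s : ℕ) (z : Fin s → R N), IsRsopPart z ∧ ∃ (m : Fin s → ℕ), (∃ l, ¬ p ∣ m l) ∧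
        ∃ u : R N, IsUnit u ∧ t₂ ^ p = (∏ l, ((z l : R N) : K) ^ m l) * (u : K))
    (hdiv : ∀ x : ℕ → K, (∀ i, x i ∈ R i ∧ x i ≠ 0 ∧ O.valuation (x i) < 1 ∧
        ∀ y ∈ R i, O.valuation y < 1 → O.valuation y ≤ O.valuation (x i)) →
      ∀ c : K, c ≠ 0 → ∃ n, (∏ i ∈ Finset.range n, O.valuation (x i)) < O.valuation c) :
    ∀ w : K, w ≠ 0 → ∃ (M : ℕ) (g : K), g ∈ R M ∧ O.valuation (t - g) < O.valuation w := by
  classical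
  haveI : Fact p.Prime := ⟨hp⟩
  haveI : CharP K p := charP_of_injective_algebraMap (algebraMap k K).injective p
  -- members: regular, dominated, monotone, made of fractions of `A₀`
  obtain ⟨hRreg, hRdom, hmono, hRfrac⟩ := sequence_facts O A₀ h₀ hreg R hR0 hstep
  haveI : ∀ i, IsRegularLocalRing (R i) := hRreg
  have hRO : ∀ i, R i ≤ O.toSubring := fun i => (hRdom i).1
  have hmax : ∀ i (y : R i), y ∈ maximalIdeal (R i) ↔ O.valuation (y : K) < 1 := fun i =>
    (subringDominates_valuationSubring_iff (hRO i)).mp (hRdom i)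
  have hA₀R : ∀ y ∈ A₀, y ∈ R 0 := fun y hy => by
    rw [hR0]
    exact le_locAtCentre A₀.toSubring O hy
  have hk : ∀ i, ∀ c : k, algebraMap k K c ∈ R i := fun i c =>
    hmono (Nat.zero_le i) (hA₀R _ (A₀.algebraMap_mem c))
  have htR : t ^ p ∈ R 0 := hA₀R _ htp
  -- `t - g ∉ Frac A₀` and `t ≠ g` for members `g`
  have htg : ∀ (M : ℕ) (g : K), g ∈ R M → ¬ ∃ y ∈ A₀, ∃ z ∈ A₀, z ≠ 0 ∧ t - g = y / z := by
    intro M g hg hfr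
    apply htF
    rw [exists_div_iff_mem_closure] at hfr ⊢
    have hg' := (exists_div_iff_mem_closure A₀ g).mp (hRfrac M g hg)
    have := add_mem hfr hg'
    rwa [sub_add_cancel] at this
  have htne : ∀ (M : ℕ) (g : K), g ∈ R M → (t - g) ^ p ≠ 0 := by
    intro M g hg h0
    have htg0 : t = g := sub_eq_zero.mp (pow_eq_zero_iff hp.ne_zero |>.mp h0)
    exact htF (htg0 ▸ hRfrac M g hg)
  -- exceptional parameters of the members, and divergence of their values
  have hexc : ∀ i, ∃ x : K, x ∈ R i ∧ x ≠ 0 ∧ O.valuation x < 1 ∧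
      ∀ y ∈ R i, O.valuation y < 1 → O.valuation y ≤ O.valuation x := by
    intro i
    obtain ⟨_, x₀, hx₀m, hx₀0, hx₀max, -⟩ := (hstep i).exists_eq_locAtCentre
    refine ⟨x₀, x₀.2, fun h0 => hx₀0 (Subtype.ext h0), (hmax i x₀).mp hx₀m, fun y hy hvy => ?_⟩
    exact hx₀max ⟨y, hy⟩ ((hmax i ⟨y, hy⟩).mpr hvy)
  choose x hx using hexc
  -- the lazy framed run: the invariant at every member
  have key : ∀ M : ℕ, ∃ g : K, g ∈ R M ∧ ∃ (s : ℕ) (z : Fin s → R M), IsRsopPart z ∧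
      ∃ (E : Fin s → ℕ) (u : R M), IsUnit u ∧ ∃ r : K, r ∈ R M ∧ r ≠ 0 ∧ O.valuation r < 1 ∧
        (t - g) ^ p = (∏ l, ((z l : R M) : K) ^ E l) * (u : K) * r ∧
        O.valuation ((∏ l, ((z l : R M) : K) ^ E l) * (u : K)) ≤
          ∏ i ∈ Finset.range M, O.valuation (x i) := by
    intro M
    induction M with
    | zero =>
      -- a one-element frame of `R 0`
      have hne : maximalIdeal (R 0) ≠ ⊥ := by
        intro hbot
        have hm : (⟨x 0, (hx 0).1⟩ : R 0) ∈ maximalIdeal (R 0) := (hmax 0 _).mpr (hx 0).2.2.1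
        rw [hbot, Ideal.mem_bot] at hm
        exact (hx 0).2.1 (congrArg Subtype.val hm)
      obtain ⟨z₀, hz₀⟩ := exists_isRsopPart_one hne
      -- a cleaner of `t ^ p` into the maximal ideal of `R 0` (perfect residue field)
      have hclean : ∃ g ∈ R 0, O.valuation (t ^ p - g ^ p) < 1 := by
        by_cases hvt : O.valuation (t ^ p) < 1
        · exact ⟨0, Subring.zero_mem _, by rwa [zero_pow hp.ne_zero, sub_zero]⟩
        · have hvt1 : O.valuation (t ^ p) = 1 :=
            le_antisymm ((O.valuation_le_one_iff _).mpr (hRO 0 htR)) (not_lt.mp hvt)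
          have hu : IsUnit (⟨t ^ p, htR⟩ : R 0) := by
            rw [isUnit_subring_iff_inv_mem]
            refine ⟨pow_ne_zero p fun h => ?_, (hRdom 0).2 _ htR ((O.valuation_le_one_iff _).mp
              (by rw [map_inv₀, hvt1, inv_one]))⟩
            exact htF ⟨0, A₀.zero_mem, 1, A₀.one_mem, one_ne_zero, by rw [h, zero_div]⟩
          haveI : PerfectField (ResidueField (R 0)) :=
            MonomialStage.perfectField_residueField hzd (hRdom 0) (hk 0)
          obtain ⟨c, -, hcm⟩ := MonomialStage.exists_isUnit_sub_pow_mem_maximalIdeal (S := R 0) p hu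
          refine ⟨(c : K), c.2, ?_⟩
          have := (hmax 0 _).mp hcm
          simpa using this
      obtain ⟨g, hg, hvg⟩ := hclean
      refine ⟨g, hg, 1, z₀, hz₀, fun _ => 0, 1, isUnit_one, t ^ p - g ^ p,
        Subring.sub_mem _ htR (Subring.pow_mem _ hg p), ?_, hvg, ?_, by simp⟩
      · rw [← sub_pow_char]
        exact htne 0 g hg
      · rw [sub_pow_char]
        simp
    | succ M ih =>
      obtain ⟨g, hg, s, z, hz, E, u, hu, r, hr, hr0, hvr, heq, hval⟩ := ih
      obtain ⟨x', hx'R, hx'0, hvx', hx'max, hx'div, s₁, z₁, hz₁, Hz, e', u', hu', hx'e⟩ :=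
        exists_frame_step O (R M) (R (M + 1)) (hRdom M) (hRdom (M + 1)) (hstep M) z hz
      have hle : R M ≤ R (M + 1) := hmono (Nat.le_succ M)
      -- `v x' = v (x M)`
      have hvxx : O.valuation x' = O.valuation (x M) :=
        le_antisymm ((hx M).2.2.2 x' hx'R hvx') (hx'max (x M) (hx M).1 (hx M).2.2.1)
      -- `P · x'` is a monomial of the new frame
      obtain ⟨E₁, u₁, hu₁, hP₁⟩ := monomial_transport hle Hz E hu rfl
      have hPx := monomial_mul z₁ hP₁ hx'e
      have hux : IsUnit (u₁ * u') := hu₁.mul hu'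
      -- the new remainder
      have hr' : r / x' ∈ R (M + 1) := hx'div r hr hvr
      have hrr : r = x' * (r / x') := by rw [mul_div_cancel₀ _ hx'0]
      have hr'0 : r / x' ≠ 0 := div_ne_zero hr0 hx'0
      have heq' : (t - g) ^ p =
          (∏ l, ((z₁ l : R (M + 1)) : K) ^ (E₁ l + e' l)) * ((u₁ * u' : R (M + 1)) : K) * (r / x') := by
        rw [heq, ← hPx, mul_assoc _ x' (r / x'), ← hrr]
      have hval' : O.valuation ((∏ l, ((z₁ l : R (M + 1)) : K) ^ (E₁ l + e' l)) *
          ((u₁ * u' : R (M + 1)) : K)) ≤ ∏ i ∈ Finset.range (M + 1), O.valuation (x i) := by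
        rw [← hPx, map_mul, Finset.prod_range_succ, hvxx]
        exact mul_le_mul' hval le_rfl
      by_cases hvr' : O.valuation (r / x') < 1
      · -- the remainder is still a non-unit: keep `g`
        exact ⟨g, hle hg, s₁, z₁, hz₁, fun l => E₁ l + e' l, u₁ * u', hux, r / x', hr', hr'0, hvr',
          heq', hval'⟩
      · -- the remainder is a unit `W`: toroidal test, `p`-th root `μ`, cleaning
        have hvr'1 : O.valuation (r / x') = 1 :=
          le_antisymm ((O.valuation_le_one_iff _).mpr (hRO _ hr')) (not_lt.mp hvr')
        have hW : IsUnit (⟨r / x', hr'⟩ : R (M + 1)) := by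
          rw [isUnit_subring_iff_inv_mem]
          exact ⟨hr'0, (hRdom (M + 1)).2 _ hr' ((O.valuation_le_one_iff _).mp
            (by rw [map_inv₀, hvr'1, inv_one]))⟩
        set W : R (M + 1) := u₁ * u' * ⟨r / x', hr'⟩ with hWdef
        have hWu : IsUnit W := hux.mul hW
        have heqW : (t - g) ^ p = (∏ l, ((z₁ l : R (M + 1)) : K) ^ (E₁ l + e' l)) * (W : K) := by
          rw [heq', hWdef, Subring.coe_mul, Subring.coe_mul, mul_assoc]
          rfl
        -- all exponents are divisible by `p`
        have hall : ∀ l, p ∣ E₁ l + e' l := by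
          by_contra hcon
          push Not at hcon
          exact hnl (M + 1) inferInstance (t - g) (htg M g hg)
            ⟨s₁, z₁, hz₁, fun l => E₁ l + e' l, hcon, W, hWu, heqW⟩
        set μ : R (M + 1) := ∏ l, z₁ l ^ ((E₁ l + e' l) / p) with hμdef
        have hμp : (∏ l, ((z₁ l : R (M + 1)) : K) ^ (E₁ l + e' l)) = ((μ : R (M + 1)) : K) ^ p :=
          prod_pow_eq_pow_of_forall_dvd z₁ hall
        -- perfect residue field: `W = c ^ p + u″`
        haveI : PerfectField (ResidueField (R (M + 1))) :=
          MonomialStage.perfectField_residueField hzd (hRdom (M + 1)) (hk (M + 1))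
        obtain ⟨c, hcu, hcm⟩ :=
          MonomialStage.exists_isUnit_sub_pow_mem_maximalIdeal (S := R (M + 1)) p hWu
        have hvu'' : O.valuation (((W - c ^ p : R (M + 1)) : K)) < 1 := (hmax (M + 1) _).mp hcm
        -- the cleaned `g⁺ := g + μ c`
        have hg' : g + (μ : K) * (c : K) ∈ R (M + 1) :=
          Subring.add_mem _ (hle hg) (Subring.mul_mem _ μ.2 c.2)
        have heq'' : (t - (g + (μ : K) * (c : K))) ^ p =
            ((μ : R (M + 1)) : K) ^ p * (((W - c ^ p : R (M + 1)) : K)) := by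
          rw [← sub_sub, sub_pow_char, heqW, hμp, mul_pow]
          push_cast
          ring
        have hval'' : O.valuation ((∏ l, ((z₁ l : R (M + 1)) : K) ^ (E₁ l + e' l)) *
            ((1 : R (M + 1)) : K)) ≤ ∏ i ∈ Finset.range (M + 1), O.valuation (x i) := by
          have h1 : O.valuation (W : K) = 1 := valuation_eq_one_of_isUnit_subring (hRO _) hWu
          have h2 : O.valuation ((u₁ * u' : R (M + 1)) : K) = 1 :=
            valuation_eq_one_of_isUnit_subring (hRO _) hux
          rw [OneMemClass.coe_one, mul_one]
          have h3 := hval'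
          rw [map_mul, h2, mul_one] at h3
          exact h3
        refine ⟨g + (μ : K) * (c : K), hg', s₁, z₁, hz₁, fun l => E₁ l + e' l, 1, isUnit_one,
          ((W - c ^ p : R (M + 1)) : K), SetLike.coe_mem _, ?_, hvu'', ?_, hval''⟩
        · intro h0
          apply htne (M + 1) _ hg'
          rw [heq'', h0, mul_zero]
        · rw [heq'', hμp, OneMemClass.coe_one, mul_one]
  -- conclusion: the values `∏_{i<M} v (x i)` tend to `0`
  intro w hw
  obtain ⟨n, hn⟩ := hdiv x hx (w ^ p) (pow_ne_zero p hw)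
  obtain ⟨g, hg, s, z, hz, E, u, hu, r, hr, hr0, hvr, heq, hval⟩ := key n
  refine ⟨n, g, hg, ?_⟩
  have hlt : O.valuation ((t - g) ^ p) < O.valuation (w ^ p) := by
    rw [heq, map_mul]
    calc O.valuation ((∏ l, ((z l : R n) : K) ^ E l) * (u : K)) * O.valuation r
        ≤ O.valuation ((∏ l, ((z l : R n) : K) ^ E l) * (u : K)) * 1 :=
          mul_le_mul' le_rfl hvr.le
      _ ≤ ∏ i ∈ Finset.range n, O.valuation (x i) := by rw [mul_one]; exact hval
      _ < O.valuation (w ^ p) := hn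
  rw [map_pow, map_pow] at hlt
  exact lt_of_pow_lt_pow_left' p hlt

/-- **Corollary (the `Frac A₀` form).** Under the hypotheses of `dense_of_forall_not_toroidal`, for every non-zero `w`
there is a fraction `g` of `A₀` lying in `O` with `v (t - g) < v w` — the negation of the «finite distance» cut
`DistFinite` of the strategist census (D1), i.e. `t` lies in the closure of `Frac A₀`. OURS. [folklore] -/
theorem exists_frac_valuation_sub_lt (p : ℕ) (hp : p.Prime) [CharP k p] [PerfectField k]
    (O : ValuationSubring K) (A₀ : Subalgebra k K) (h₀ : A₀.toSubring ≤ O.toSubring) (t : K)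
    (htp : t ^ p ∈ A₀)
    (hreg : IsRegularLocalRing (Localization.AtPrime
      (Ideal.comap (Subring.inclusion h₀) (IsLocalRing.maximalIdeal O))))
    (hzd : ∀ x ∈ O, ∃ f : Polynomial k, f ≠ 0 ∧ Polynomial.aeval (R := k) x f ∈ O.nonunits)
    (htF : ¬ ∃ y ∈ A₀, ∃ z ∈ A₀, z ≠ 0 ∧ t = y / z)
    (R : ℕ → Subring K) (hR0 : R 0 = locAtCentre A₀.toSubring O)
    (hstep : ∀ i, IsQuadraticTransformAlong O (R i) (R (i + 1)))
    (hnl : ∀ (N : ℕ) (_ : IsLocalRing (R N)) (t₂ : K), ¬ (∃ y ∈ A₀, ∃ z ∈ A₀, z ≠ 0 ∧ t₂ = y / z) →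
      ¬ ∃ (s : ℕ) (z : Fin s → R N), IsRsopPart z ∧ ∃ (m : Fin s → ℕ), (∃ l, ¬ p ∣ m l) ∧
        ∃ u : R N, IsUnit u ∧ t₂ ^ p = (∏ l, ((z l : R N) : K) ^ m l) * (u : K))
    (hdiv : ∀ x : ℕ → K, (∀ i, x i ∈ R i ∧ x i ≠ 0 ∧ O.valuation (x i) < 1 ∧
        ∀ y ∈ R i, O.valuation y < 1 → O.valuation y ≤ O.valuation (x i)) →
      ∀ c : K, c ≠ 0 → ∃ n, (∏ i ∈ Finset.range n, O.valuation (x i)) < O.valuation c)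
    (w : K) (hw : w ≠ 0) :
    ∃ g : K, g ∈ O ∧ (∃ y ∈ A₀, ∃ z ∈ A₀, z ≠ 0 ∧ g = y / z) ∧ O.valuation (t - g) < O.valuation w := by
  obtain ⟨-, hRdom, -, hRfrac⟩ := sequence_facts O A₀ h₀ hreg R hR0 hstep
  obtain ⟨M, g, hg, hlt⟩ := dense_of_forall_not_toroidal p hp O A₀ h₀ t htp hreg hzd htF R hR0 hstep
    hnl hdiv w hw
  exact ⟨g, (hRdom M).1 hg, hRfrac M g hg, hlt⟩

end EventualMonomial

end Summit.ResolutionOfSingularities.ResolutionOfSingularities.Theorems.SwitchingDichotomy
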